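/-
Copyright: the b2b-balaban T⁴-continuum CRUX team, row NE7b OWNER lineage `t4-ne7b-p1` (gen 145). Project licence.
-/
import Summits.QuantumFields.BalabanUV.T4Continuum.Spine.NE7b.SupWeightedThirdOrderLetters

/-!
# THE WEIGHTED OUTPUT LETTERS AT ORDER THREE, SECOND FILE: THE MIDDLE-INDEX ROLE `k3mϑ⁺` (SCOPING-d17 (R-c); (657) continued — the 400-line
# cap splits the three roles 2 + 1).  Same objects, weights and routing as (657): full-graph weight `ϑ_{yx}ϑ_{yv}ϑ_{xv}` with `y` (the SECOND
# index of `K3⁺_{xyv} = M₃(v;x,y)`) fixed; apex inequality, `ϑ² ≤ ϑ₂`, `ϑ² ≤ σσ`, masters (653)∕(656):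
#   `Σ_{x,v} M₃(v;x,y)·ϑ_{yx}ϑ_{yv}ϑ_{xv} ≤ k3mϑ + (2·dθ·αg2m·dθ′·αθc + dθ·αθ·dθ′·αg1c)∕(1−lamA) + C₃·Sϑ2²`
# (row NE7b, node U5c; (657) `tree_sq_sum_le'`, (653), (656) BY NAME; [folklore]).  With (652)/(657) the weighted class CLOSES at orders 2–3
# given the profile letters (supplement file: their discharge from the full-graph `ϑ₂`-letters).

Cell `pub-balaban`, sub-cell `t4`, spine estimate NE7b (`T4WeightBudget.RelWeightBound`; the cell's OWN estimate — NOT PRINTED in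
[Bałaban 1983–89], NOT PROVED).  Crux-route work under `Spine/NE7b/` by the row OWNER (`t4-ne7b-p1` gen 145, file (658)) under FREEZE
(0)'s crux-prover clause; NOTHING of Bałaban's is named as a Lean object, valued or asserted; no `T4Continuum/Support` leaf typed; no
`def`, no notation; zero `sorry`.  Imports (BY NAME): the OWNER's (657) `…SupWeightedThirdOrderLetters` ((656), (653) through it).

WHAT IS PROVED ([folklore]): THE END **`output_k3mϑ`**; toy.

HONEST (what this is NOT).  One role; see (657).  Scalar skeleton ((A3), NC-NE7b-α UNRULED); nothing of Bałaban's asserted.  BY-NAME EFFECT ON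
THE WALL: NONE.  NE7b NOT PRINTED ∕ NOT PROVED; spine PROVED 0∕9; rung (B)+1 — the programme's measures remain FINITE-torus statements; NOT the
mass gap, NOT Clay.  HONEST DEPENDENCY: continuum YM on T⁴ ⇐ BetaPertH ∧ nine spine estimates (0∕9 proved); BetaPertH ⇐ (D1) ∧ (D4) ∧ CAP+tail;
G-an2-4 gates asym, D1 and NE2∕3∕4.
-/

set_option autoImplicit false

noncomputable section

namespace Summit.QuantumFields.BalabanUV.T4Continuum.NE7b.SupWeightedThirdOrderLettersTwo

open Finset Real Matrix
open scoped BigOperators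
open SupWeightedTwoPointMasters (weighted_two_point_family_le weighted_two_point_family_le')
open SupWeightedTwoPointMastersTwo (weighted_two_point_two_families_le weighted_two_point_two_families_le')
open SupWeightedThirdOrderLetters (tree_sq_sum_le')

variable {ι κ : Type} [Fintype ι] [Fintype κ]

variable {Hk : ι → ι → ℝ} {K3 : ι → ι → ι → ℝ} {A : Matrix ι κ ℝ} {D : κ → κ → ℝ} {ϑ ϑ₂ ρ : ι → ι → ℝ} {σ : ι → κ → ℝ} {θ : κ → κ → ℝ}
  {γop κ₂ lam lamA dθ dθ' αθ βθ αθc αg1m αg2m αg1c k3cϑ k3rϑ k3mϑ Sϑ2 : ℝ}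

/-- **`k3mϑ⁺`** (`y` fixed — the second index; full-graph weight `ϑ_{yx}ϑ_{yv}ϑ_{xv}`). [folklore] -/
theorem output_k3mϑ (hK30 : ∀ x y u, 0 ≤ K3 x y u) (hHk0 : ∀ v u, 0 ≤ Hk v u) (hD : ∀ x y, 0 ≤ D x y) (hlamA1 : lamA < 1)
    (hθnn : ∀ z w, 0 ≤ θ z w) (hDr : ∀ z', ∑ w, D z' w * θ z' w ≤ dθ) (hdθ : 0 ≤ dθ) (hDc : ∀ w, ∑ z', D z' w * θ z' w ≤ dθ') (hdθ' : 0 ≤ dθ')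
    (hσ0 : ∀ x w, 0 ≤ σ x w) (hσθ : ∀ x z' w, σ x w ≤ σ x z' * θ z' w)
    (hϑ1 : ∀ x y, 1 ≤ ϑ x y) (hϑsymm : ∀ x y, ϑ x y = ϑ y x) (hϑmul : ∀ x y z, ϑ x z ≤ ϑ x y * ϑ y z) (hϑ2 : ∀ x y, ϑ x y * ϑ x y ≤ ϑ₂ x y)
    (hϑ₂1 : ∀ x y, 1 ≤ ϑ₂ x y) (hϑσ : ∀ x y w, ϑ x y * ϑ x y ≤ σ x w * σ y w) (hρ0 : ∀ x y, 0 < ρ x y) (hρsymm : ∀ x y, ρ x y = ρ y x)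
    (hS2 : ∀ v, ∑ x, ϑ v x * ϑ v x / ρ v x ≤ Sϑ2) (hCT : 0 ≤ 4 * Real.sqrt (5 * (κ₂ ^ 4 * γop ^ 2) / (1 - lam * γop) ^ 2 * (αθ * dθ * (βθ * dθ') /
        (1 - lamA))))
    (hbσ : ∀ v, ∑ z', (∑ u, |A u z'| * Hk v u) * σ v z' ≤ αθ) (hbσc : ∀ z', ∑ v, (∑ u, |A u z'| * Hk v u) * σ v z' ≤ αθc) (hαθc : 0 ≤ αθc)
    (hg2m : ∀ y, ∑ x, ϑ₂ y x * ∑ z', (∑ u, |A u z'| * K3 x y u) * σ y z' ≤ αg2m)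
    (hg1c : ∀ z', ∑ x, ∑ y, (∑ u, |A u z'| * K3 x y u) * (σ x z' * ϑ₂ x y) ≤ αg1c) (hαg1c : 0 ≤ αg1c)
    (hk3m : ∀ y, ∑ x, ∑ v, K3 x y v * (ϑ₂ y x * ϑ₂ y v * ϑ₂ x v) ≤ k3mϑ) (y : ι) :
    ∑ x, ∑ v, (K3 x y v + ∑ w, (∑ z', D z' w * ∑ u, |A u z'| * K3 v y u) * (∑ z', D z' w * ∑ u, |A u z'| * Hk x u) / (1 - lamA) + ∑ w, (∑ z', D z'
        w * ∑ u, |A u z'| * K3 v x u) * (∑ z', D z' w * ∑ u, |A u z'| * Hk y u) / (1 - lamA) + ∑ w, (∑ z', D z' w * ∑ u, |A u z'| * Hk v u) * (∑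
        z', D z' w * ∑ u, |A u z'| * K3 x y u) / (1 - lamA) + 4 * Real.sqrt (5 * (κ₂ ^ 4 * γop ^ 2) / (1 - lam * γop) ^ 2 * (αθ * dθ * (βθ * dθ') /
        (1 - lamA))) / (ρ v x * ρ v y)) * (ϑ y x * ϑ y v * ϑ x v) ≤
      k3mϑ + (dθ * αg2m * (dθ' * αθc) / (1 - lamA) + dθ * αθ * (dθ' * αg1c) / (1 - lamA) + dθ * αg2m * (dθ' * αθc) / (1 - lamA)) + 4 * Real.sqrt (5
        * (κ₂ ^ 4 * γop ^ 2) / (1 - lam * γop) ^ 2 * (αθ * dθ * (βθ * dθ') / (1 - lamA))) * Sϑ2 ^ 2 := by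
  have hl : 0 < 1 - lamA := by linarith
  have hϑ0 : ∀ x y, 0 ≤ ϑ x y := fun x y => zero_le_one.trans (hϑ1 x y)
  have hϑ₂0 : ∀ x y, 0 ≤ ϑ₂ x y := fun x y => zero_le_one.trans (hϑ₂1 x y)
  have hϑϑ₂ : ∀ x y, ϑ x y ≤ ϑ₂ x y := fun x y => le_trans (by nlinarith [hϑ1 x y]) (hϑ2 x y)
  have hg0 : ∀ (p q : ι) (z' : κ), 0 ≤ ∑ u, |A u z'| * K3 p q u := fun p q z' => sum_nonneg fun u _ => mul_nonneg (abs_nonneg _) (hK30 p q u)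
  have hb0 : ∀ (r : ι) (z' : κ), 0 ≤ ∑ u, |A u z'| * Hk r u := fun r z' => sum_nonneg fun u _ => mul_nonneg (abs_nonneg _) (hHk0 r u)
  have hE0 : ∀ (p q r : ι), 0 ≤ ∑ w, (∑ z', D z' w * ∑ u, |A u z'| * K3 p q u) * (∑ z', D z' w * ∑ u, |A u z'| * Hk r u) / (1 - lamA) :=
    fun p q r => sum_nonneg fun w _ => div_nonneg (mul_nonneg (sum_nonneg fun z' _ => mul_nonneg (hD z' w) (hg0 p q z'))
      (sum_nonneg fun z' _ => mul_nonneg (hD z' w) (hb0 r z'))) hl.le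
  have hE0' : ∀ (p q r : ι), 0 ≤ ∑ w, (∑ z', D z' w * ∑ u, |A u z'| * Hk r u) * (∑ z', D z' w * ∑ u, |A u z'| * K3 p q u) / (1 - lamA) :=
    fun p q r => sum_nonneg fun w _ => div_nonneg (mul_nonneg (sum_nonneg fun z' _ => mul_nonneg (hD z' w) (hb0 r z'))
      (sum_nonneg fun z' _ => mul_nonneg (hD z' w) (hg0 p q z'))) hl.le
  -- the full-graph weight on a triangle with apex `a`: `ϑab·ϑac·ϑbc ≤ ϑab²·ϑac²`
  have hW : ∀ a b c, ϑ a b * ϑ a c * ϑ b c ≤ (ϑ a b * ϑ a b) * (ϑ a c * ϑ a c) := fun a b c => by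
    have h := hϑmul b a c; rw [hϑsymm b a] at h
    calc ϑ a b * ϑ a c * ϑ b c ≤ ϑ a b * ϑ a c * (ϑ a b * ϑ a c) := mul_le_mul_of_nonneg_left h (mul_nonneg (hϑ0 a b) (hϑ0 a c))
      _ = (ϑ a b * ϑ a b) * (ϑ a c * ϑ a c) := by ring
  have hW1 : ∀ a b c, ϑ a b * ϑ a c * ϑ b c ≤ ϑ₂ a b * (ϑ a c * ϑ a c) := fun a b c =>
    (hW a b c).trans (mul_le_mul_of_nonneg_right (hϑ2 a b) (mul_self_nonneg _))
  have hW2 : ∀ a b c, ϑ a b * ϑ a c * ϑ b c ≤ (ϑ a b * ϑ a b) * ϑ₂ a c := fun a b c =>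
    (hW a b c).trans (mul_le_mul_of_nonneg_left (hϑ2 a c) (mul_self_nonneg _))
  have hW3 : ∀ a b c, ϑ a b * ϑ a c * ϑ b c ≤ ϑ₂ a b * ϑ₂ a c * ϑ₂ b c := fun a b c =>
    mul_le_mul (mul_le_mul (hϑϑ₂ a b) (hϑϑ₂ a c) (hϑ0 a c) (hϑ₂0 a b)) (hϑϑ₂ b c) (hϑ0 b c) (mul_nonneg (hϑ₂0 a b) (hϑ₂0 a c))
  -- T1
  have h1 : ∑ x, ∑ v, K3 x y v * (ϑ y x * ϑ y v * ϑ x v) ≤ k3mϑ :=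
    (sum_le_sum fun x _ => sum_le_sum fun v _ => mul_le_mul_of_nonneg_left (hW3 y x v) (hK30 x y v)).trans (hk3m y)
  -- T2: E(g^{vy}, b^x): anchor family v ↦ g^{vy} (second index y fixed; α = ϑ₂ y v), leg x (β = ϑyx²); anchor factor first
  have h2 : ∑ x, ∑ v, (∑ w, (∑ z', D z' w * ∑ u, |A u z'| * K3 v y u) * (∑ z', D z' w * ∑ u, |A u z'| * Hk x u) / (1 - lamA)) * (ϑ y x * ϑ y v * ϑ
        x v) ≤ dθ * αg2m * (dθ' * αθc) / (1 - lamA) := by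
    have h := weighted_two_point_two_families_le' (R := ι) (S := ι) (g := fun v z' => ∑ u, |A u z'| * K3 v y u) (α := fun v => ϑ₂ y v)
      (b := fun x z' => ∑ u, |A u z'| * Hk x u) (σ := fun w => σ y w) (σ₁ := fun z' => σ y z') (σ' := fun x w => σ x w) (σ'₁ := fun x z' => σ x z')
      (β := fun x => ϑ y x * ϑ y x) (fun v z' => hg0 v y z') (fun v => hϑ₂0 y v) (fun x z' => hb0 x z') hD hθnn (fun w => hσ0 y w)
      (fun z' => hσ0 y z') (fun x w => hϑσ y x w) (fun z' w => hσθ y z' w) (fun x z' w => hσθ x z' w) hDr hdθ hDc hdθ' (hg2m y) hbσc hαθc hlamA1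
    rw [sum_comm] at h
    refine le_trans (sum_le_sum fun x _ => sum_le_sum fun v _ => ?_) h
    exact mul_le_mul_of_nonneg_left ((hW2 y x v).trans (le_of_eq (by ring))) (hE0 v y x)
  -- T3: E(g^{vx}, b^y): one-point anchor b^y (second factor), family (x,v) ↦ g^{vx} with internal weight ϑ₂ v x: W ≤ ϑyv²·ϑ₂vx
  have h3 : ∑ x, ∑ v, (∑ w, (∑ z', D z' w * ∑ u, |A u z'| * K3 v x u) * (∑ z', D z' w * ∑ u, |A u z'| * Hk y u) / (1 - lamA)) * (ϑ y x * ϑ y v * ϑ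
        x v) ≤ dθ * αθ * (dθ' * αg1c) / (1 - lamA) := by
    have hβ : ∀ (p : ι × ι) (w : κ), ϑ y p.2 * ϑ y p.2 * ϑ₂ p.2 p.1 ≤ σ y w * (σ p.2 w * ϑ₂ p.2 p.1) := fun p w => by
      calc ϑ y p.2 * ϑ y p.2 * ϑ₂ p.2 p.1 ≤ σ y w * σ p.2 w * ϑ₂ p.2 p.1 := mul_le_mul_of_nonneg_right (hϑσ y p.2 w) (hϑ₂0 p.2 p.1)
        _ = σ y w * (σ p.2 w * ϑ₂ p.2 p.1) := by ring
    have h := weighted_two_point_family_le (R := ι × ι) (a := fun z' => ∑ u, |A u z'| * Hk y u) (b := fun p z' => ∑ u, |A u z'| * K3 p.2 p.1 u)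
      (σ := fun w => σ y w) (σ₁ := fun z' => σ y z') (σ' := fun p w => σ p.2 w * ϑ₂ p.2 p.1) (σ'₁ := fun p z' => σ p.2 z' * ϑ₂ p.2 p.1)
      (ϑ := fun p => ϑ y p.2 * ϑ y p.2 * ϑ₂ p.2 p.1) (fun z' => hb0 y z') (fun p z' => hg0 p.2 p.1 z') hD hθnn (fun w => hσ0 y w) (fun z' => hσ0 y z')
      hβ (fun z' w => hσθ y z' w) (fun p z' w => by
        calc σ p.2 w * ϑ₂ p.2 p.1 ≤ σ p.2 z' * θ z' w * ϑ₂ p.2 p.1 := mul_le_mul_of_nonneg_right (hσθ p.2 z' w) (hϑ₂0 p.2 p.1)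
          _ = σ p.2 z' * ϑ₂ p.2 p.1 * θ z' w := by ring)
      hDr hdθ hDc hdθ' (hbσ y) (fun z' => by rw [Fintype.sum_prod_type, sum_comm]; exact hg1c z') hαg1c hlamA1
    rw [Fintype.sum_prod_type] at h
    refine le_trans (sum_le_sum fun x _ => sum_le_sum fun v _ => ?_) h
    refine mul_le_mul_of_nonneg_left ?_ (hE0 v x y)
    have hyx := hϑmul y v x
    calc (ϑ y x * ϑ y v * ϑ x v) ≤ (ϑ y v * ϑ v x) * ϑ y v * ϑ x v := (mul_le_mul_of_nonneg_right (mul_le_mul_of_nonneg_right hyx (hϑ0 y v)) (hϑ0 x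
        v))
      _ = ϑ y v * ϑ y v * (ϑ v x * ϑ x v) := by ring
      _ = ϑ y v * ϑ y v * (ϑ v x * ϑ v x) := by rw [hϑsymm x v]
      _ ≤ ϑ y v * ϑ y v * ϑ₂ v x := mul_le_mul_of_nonneg_left (hϑ2 v x) (mul_self_nonneg _)
  -- T4: E(b^v, g^{xy}): anchor family x ↦ g^{xy} (second index y fixed; α = ϑ₂ y x), leg v (β = ϑyv²); leg factor first
  have h4 : ∑ x, ∑ v, (∑ w, (∑ z', D z' w * ∑ u, |A u z'| * Hk v u) * (∑ z', D z' w * ∑ u, |A u z'| * K3 x y u) / (1 - lamA)) * (ϑ y x * ϑ y v * ϑ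
        x v) ≤ dθ * αg2m * (dθ' * αθc) / (1 - lamA) := by
    have h := weighted_two_point_two_families_le (R := ι) (S := ι) (g := fun x z' => ∑ u, |A u z'| * K3 x y u) (α := fun x => ϑ₂ y x)
      (b := fun v z' => ∑ u, |A u z'| * Hk v u) (σ := fun w => σ y w) (σ₁ := fun z' => σ y z') (σ' := fun v w => σ v w) (σ'₁ := fun v z' => σ v z')
      (β := fun v => ϑ y v * ϑ y v) (fun x z' => hg0 x y z') (fun x => hϑ₂0 y x) (fun v z' => hb0 v z') hD hθnn (fun w => hσ0 y w)
      (fun z' => hσ0 y z') (fun v w => hϑσ y v w) (fun z' w => hσθ y z' w) (fun v z' w => hσθ v z' w) hDr hdθ hDc hdθ' (hg2m y) hbσc hαθc hlamA1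
    refine le_trans (sum_le_sum fun x _ => sum_le_sum fun v _ => ?_) h
    exact mul_le_mul_of_nonneg_left ((hW1 y x v).trans (le_of_eq (by ring))) (hE0' x y v)
  -- T5: tree (v,x),(v,y): W ≤ ϑyv²·ϑvx²
  have h5 : ∑ x, ∑ v, (4 * Real.sqrt (5 * (κ₂ ^ 4 * γop ^ 2) / (1 - lam * γop) ^ 2 * (αθ * dθ * (βθ * dθ') / (1 - lamA))) / (ρ v x * ρ v y)) * (ϑ y
        x * ϑ y v * ϑ x v) ≤ 4 * Real.sqrt (5 * (κ₂ ^ 4 * γop ^ 2) / (1 - lam * γop) ^ 2 * (αθ * dθ * (βθ * dθ') / (1 - lamA))) * Sϑ2 ^ 2 := by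
    calc ∑ x, ∑ v, (4 * Real.sqrt (5 * (κ₂ ^ 4 * γop ^ 2) / (1 - lam * γop) ^ 2 * (αθ * dθ * (βθ * dθ') / (1 - lamA))) / (ρ v x * ρ v y)) * (ϑ y x
        * ϑ y v * ϑ x v)
        ≤ ∑ x, ∑ v, 4 * Real.sqrt (5 * (κ₂ ^ 4 * γop ^ 2) / (1 - lam * γop) ^ 2 * (αθ * dθ * (βθ * dθ') / (1 - lamA))) * ((ϑ y v * ϑ y v) * (ϑ v x
        * ϑ v x) / (ρ v y * ρ v x)) := by
          refine sum_le_sum fun x _ => sum_le_sum fun v _ => ?_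
          rw [div_mul_eq_mul_div, mul_div_assoc, mul_comm (ρ v x) (ρ v y)]
          refine mul_le_mul_of_nonneg_left (div_le_div_of_nonneg_right ?_ (mul_pos (hρ0 v y) (hρ0 v x)).le) hCT
          have hyx := hϑmul y v x
          calc (ϑ y x * ϑ y v * ϑ x v) ≤ (ϑ y v * ϑ v x) * ϑ y v * ϑ x v := (mul_le_mul_of_nonneg_right (mul_le_mul_of_nonneg_right hyx (hϑ0 y v))
        (hϑ0 x v))
            _ = (ϑ y v * ϑ y v) * (ϑ v x * ϑ x v) := by ring
            _ = (ϑ y v * ϑ y v) * (ϑ v x * ϑ v x) := by rw [hϑsymm x v]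
      _ = 4 * Real.sqrt (5 * (κ₂ ^ 4 * γop ^ 2) / (1 - lam * γop) ^ 2 * (αθ * dθ * (βθ * dθ') / (1 - lamA))) * ∑ x, ∑ v, (ϑ y v * ϑ y v) * (ϑ v x *
        ϑ v x) / (ρ v y * ρ v x) := by
          rw [mul_sum]; exact sum_congr rfl fun x _ => by rw [mul_sum]
      _ ≤ 4 * Real.sqrt (5 * (κ₂ ^ 4 * γop ^ 2) / (1 - lam * γop) ^ 2 * (αθ * dθ * (βθ * dθ') / (1 - lamA))) * Sϑ2 ^ 2 := mul_le_mul_of_nonneg_left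
        (tree_sq_sum_le' hρ0 hρsymm hS2 y) hCT
  simp only [add_mul, sum_add_distrib]
  linarith [h1, h2, h3, h4, h5]

/-! ## Toy -/

/-- Toy (the roles' bookkeeping): the middle-index letter uses the second-index mass twice, `2m + c`. -/
example (m c : ℝ) : m + c + m = 2 * m + c := by ring

end Summit.QuantumFields.BalabanUV.T4Continuum.NE7b.SupWeightedThirdOrderLettersTwo

end
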